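import Summits.BirchSwinnertonDyer.BirchSwinnertonDyer.Theorems.KimAtThreeDeepLowerS24DeepRigidity
import Summits.BirchSwinnertonDyer.Rank1Residual.GaloisImage.KolyvaginDeepDatum
import Summits.BirchSwinnertonDyer.Rank1Residual.GaloisImage.CanonicalKolyvaginDatum
import HarnessLib

/-!
# Data bookkeeping for the S24-DEEP discharge: changing the primitive roots off the primes, extending
# a deep-class datum to the pinned class, and the TOWER of deep-class data below a given depth
# (route `KimAtThreeKolyvagin`, rung W2; cell `bsd-addord`, seat `bsd-addord-w2-c2` gen 5)

HONEST FRAMING. TOOL theorems (existence statements about Kolyvagin DATA — prime sets, transverse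
conditions, comparison maps; no cohomology is computed), no definition, no named fact, no `sorry`;
nothing booked; BSD is not proved by any of this. They feed `KimAtThreeDeepLowerS24DeepOfPinned` (the
S24-DEEP (1) port from the pinned [S24] fact): n1011's constructors
`FSComp.exists_kolyvaginDatum_hasCanonicalComparison_frobeniusClassPrimes` (pinned class) and
`S24Deep.exists_kolyvaginDatum_hasCanonicalComparison_frobeniusClassPrimes_deep` (deep class) re-packaged:

* `hasCanonicalComparison_congr` — `HasCanonicalComparison N η` depends on `η` only at the primes of
  the datum;
* `exists_eta_eq_on_primes_forall_zpowers_eq_top` — over `ℚ` one may change `η` OFF the primes of a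
  datum into a system generating `(ℤ/N𝔮)ˣ` EVERYWHERE, keeping the canonical comparison;
* `exists_extension_to_frobeniusClassPrimes` — a datum `D` on a SUB-class `𝒫′ ⊆ 𝒫` of Sakamoto's
  pinned class (canonical for `η`, `η` generating everywhere) extends to a datum `D̂` on `𝒫` with the
  SAME transverse conditions, the SAME comparison maps on `𝒫′`, canonical for `η`;
* `exists_deepTower_torsion_pow_mul` — for `k ≤ k′` and a datum `D` on `E[3^k·3]` over the deep class
  `𝒫′ = frobeniusClassPrimes (E[3^{k′}·3]) S τ 3^{k′+1}` (cyclotomic transverse, canonical for `η`,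
  `η` generating everywhere), a whole tower `D j` (`j : ℕ`) of data on `E[3^j·3]` with `D k = D`
  and, for every `j ≤ k′`, primes `𝒫′`, cyclotomic transverse conditions, canonical comparison at
  `3^{j+1}` for `η`; plus `exists_deepDatum_torsion_three` — the `E[3]`-datum on `𝒫′` (canonical at `3`).

References: R. Sakamoto, JTNB **36** (2024) §2, §4, Def. 4.1 [Sakamoto2024]; K. Rubin, PCMI 18 (2011)
Def. 1.9.6, Def. 2.1.3 [Rubin2011]; C.-H. Kim, AJM 148, §2.2.2 [Kim2022StructureSelmer]; B. Mazur,
K. Rubin, Mem. AMS **799** (2004) §3.5 (H.5) [MazurRubin2004].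
-/

set_option autoImplicit false
-- the Theorems namespace of a single-conjunct summit repeats the summit name by design (D-0017)
set_option linter.dupNamespace false

noncomputable section

open scoped Classical NumberField ContRepresentation
open Function Field NumberField IsDedekindDomain
open WeierstrassCurve Literature.NumberTheory.EllipticCurves
  Literature.NumberTheory.GaloisRepresentations
  Literature.NumberTheory.GaloisRepresentations.DiscreteGaloisModule Literature.NumberTheory.GaloisCohomology

universe u

namespace Summit.BirchSwinnertonDyer.BirchSwinnertonDyer.Theorems.KimAtThreeDeepLowerS24DeepTower

open Summit.BirchSwinnertonDyer.Rank1Residual.GaloisImage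

/-! ### §1 `η` only matters at the primes -/

section Eta

variable {K : Type u} [Field K] [NumberField K] {M : Type u} [AddCommGroup M] [TopologicalSpace M]
  [DiscreteTopology M] {ρ : DiscreteGaloisModule K M}

/-- `HasCanonicalComparison N η` depends on `η` only through its values at the primes of the datum.
[cite: Kim2022StructureSelmer, §2.2.2] -/
theorem hasCanonicalComparison_congr {D : KolyvaginDatum ρ} {N : ℕ} [Module (ZMod N) M]
    [Module.Free (ZMod N) M] [Module.Finite (ZMod N) M]
    {η η' : (q : HeightOneSpectrum (𝓞 K)) → (ZMod (Ideal.absNorm q.asIdeal))ˣ}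
    (h : D.HasCanonicalComparison N η) (hη : ∀ q ∈ D.primes, η' q = η q) :
    D.HasCanonicalComparison N η' := by
  intro q hq
  refine ⟨?_, fun φ τ hφ hτ hητ => ?_⟩
  · rw [hη q hq]; exact (h q hq).1
  · rw [hη q hq] at hητ
    exact (h q hq).2 φ τ hφ hτ hητ

end Eta

/-! ### §2 Over `ℚ`: generators everywhere, and the extension to the pinned class -/

section Rat

variable {M : Type} [AddCommGroup M] [TopologicalSpace M] [DiscreteTopology M]
  (ρ : DiscreteGaloisModule ℚ M)

/-- **Changing `η` off the primes**: for a datum canonical for `η`, there is `η′`, agreeing with `η` on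
the primes and generating `(ℤ/N𝔮)ˣ` at EVERY finite place (`N𝔮 = ℓ` prime over `ℚ`, `(ℤ/ℓ)ˣ` cyclic),
for which the datum is still canonical. [cite: Kim2022StructureSelmer, §2.2.2] -/
theorem exists_eta_eq_on_primes_forall_zpowers_eq_top {D : KolyvaginDatum ρ} {N : ℕ} [Module (ZMod N) M]
    [Module.Free (ZMod N) M] [Module.Finite (ZMod N) M]
    {η : (q : HeightOneSpectrum (𝓞 ℚ)) → (ZMod (Ideal.absNorm q.asIdeal))ˣ}
    (h : D.HasCanonicalComparison N η) :
    ∃ η' : (q : HeightOneSpectrum (𝓞 ℚ)) → (ZMod (Ideal.absNorm q.asIdeal))ˣ,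
      (∀ q ∈ D.primes, η' q = η q) ∧ (∀ q, Subgroup.zpowers (η' q) = ⊤) ∧
        D.HasCanonicalComparison N η' := by
  have hgen : ∀ q : HeightOneSpectrum (𝓞 ℚ), ∃ g : (ZMod (Ideal.absNorm q.asIdeal))ˣ,
      Subgroup.zpowers g = ⊤ := fun q => by
    haveI : Fact (Ideal.absNorm q.asIdeal).Prime := ⟨FSComp.prime_absNorm_rat q⟩
    obtain ⟨g, hg⟩ := IsCyclic.exists_generator (α := (ZMod (Ideal.absNorm q.asIdeal))ˣ)
    exact ⟨g, (Subgroup.eq_top_iff' _).mpr hg⟩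
  choose g hg using hgen
  refine ⟨fun q => if q ∈ D.primes then η q else g q, fun q hq => by simp only [if_pos hq], fun q => ?_,
    hasCanonicalComparison_congr h fun q hq => by simp only [if_pos hq]⟩
  by_cases hq : q ∈ D.primes
  · simp only [if_pos hq]; exact h.zpowers_eq_top hq
  · simp only [if_neg hq]; exact hg q

/-- **Extension of a sub-class datum to Sakamoto's pinned class.** Let `D` have primes
`𝒫′ ⊆ 𝒫 = frobeniusClassPrimes ρ S τ N` and canonical comparison maps for `η` (`η` generating
everywhere); let `τ ∈ Γ_{ℚ(μ_N)}`, `T/(τ − 1)T ≃ ℤ/N`. Then there is `D̂` with primes `𝒫`, the SAME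
transverse conditions as `D`, the SAME comparison maps as `D` on `𝒫′`, and canonical comparison for `η`
(at the new primes: n1011's constructor `FSComp.exists_kolyvaginDatum_hasCanonicalComparison_frobeniusClassPrimes`;
the inclusion `𝒫′ ⊆ 𝒫` is not needed for the construction, only for its use).
[cite: Rubin2011, Def. 1.9.6 (p. 14) and Def. 2.1.3 (p. 17)] [cite: MazurRubin2004, §3.5 (H.5) (p. 27)] -/
theorem exists_extension_to_frobeniusClassPrimes {N : ℕ} [NeZero N] [Module (ZMod N) M]
    [Module.Free (ZMod N) M] [Module.Finite (ZMod N) M]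
    (S : Set (HeightOneSpectrum (𝓞 ℚ))) {τ : absoluteGaloisGroup ℚ}
    (hτ : τ ∈ rootsOfUnityFixer ℚ N) (hcoker : Nonempty (cokerSubOne ρ τ ≃+ ZMod N))
    (D : KolyvaginDatum ρ)
    (η : (q : HeightOneSpectrum (𝓞 ℚ)) → (ZMod (Ideal.absNorm q.asIdeal))ˣ)
    (hη : ∀ q, Subgroup.zpowers (η q) = ⊤) (hD : D.HasCanonicalComparison N η) :
    ∃ D' : KolyvaginDatum ρ, D'.primes = frobeniusClassPrimes ρ S τ N ∧ D'.transverse = D.transverse ∧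
      (∀ q ∈ D.primes, D.fs q = D'.fs q) ∧ D'.HasCanonicalComparison N η := by
  obtain ⟨D₀, hP₀, -, hD₀⟩ := FSComp.exists_kolyvaginDatum_hasCanonicalComparison_frobeniusClassPrimes ρ N
    S hτ hcoker D.transverse η (fun q _ => hη q)
  refine ⟨⟨frobeniusClassPrimes ρ S τ N, D.transverse,
    fun q => if q ∈ D.primes then D.fs q else D₀.fs q⟩, rfl, rfl, fun q hq => ?_, fun q hq => ?_⟩
  · change D.fs q = (if q ∈ D.primes then D.fs q else D₀.fs q)
    rw [if_pos hq]
  · by_cases hq' : q ∈ D.primes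
    · refine ⟨(hD q hq').1, fun φ τ' hφ hτ' hη' => ?_⟩
      change IsFiniteSingularComparisonWith _ N (if q ∈ D.primes then D.fs q else D₀.fs q) φ τ'
      rw [if_pos hq']
      exact (hD q hq').2 φ τ' hφ hτ' hη'
    · have hq₀ : q ∈ D₀.primes := hP₀ ▸ hq
      refine ⟨(hD₀ q hq₀).1, fun φ τ' hφ hτ' hη' => ?_⟩
      change IsFiniteSingularComparisonWith _ N (if q ∈ D.primes then D.fs q else D₀.fs q) φ τ'
      rw [if_neg hq']
      exact (hD₀ q hq₀).2 φ τ' hφ hτ' hη'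

end Rat

/-! ### §3 The tower of deep-class data on `E[3^j·3]`, `j ≤ k′`, through a given datum at depth `k` -/

section Torsion

variable (W : WeierstrassCurve ℚ) [W.IsElliptic]

/-- **The deep tower through `D`.** For `k ≤ k′`, `τ ∈ Γ_{ℚ(μ_{3^{k′+1}})}` with cyclic cokernels on
every `E[3^j·3]` (`j ≤ k′`), a datum `D` on `E[3^k·3]` over the deep class
`𝒫′ = frobeniusClassPrimes (E[3^{k′}·3]) S τ 3^{k′+1}` with cyclotomic transverse conditions and canonical
comparison for `η` (`η` generating everywhere): there is a tower `D j` of data on `E[3^j·3]` (`j : ℕ`)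
with `D k = D` and, for every `j ≤ k′`, primes `𝒫′`, cyclotomic transverse conditions and canonical
comparison at `3^{j+1}` for `η` (n1011's deep constructor at each `j ≠ k`).
[cite: Rubin2011, Def. 1.9.6 and Def. 2.1.3] [cite: MazurRubin2004, §3.5 (H.5) (p. 27) and Prop. A.2 (pp. 79–80)] -/
theorem exists_deepTower_torsion_pow_mul {k k' : ℕ} (hkk' : k ≤ k')
    (S : Set (HeightOneSpectrum (𝓞 ℚ))) {τ : absoluteGaloisGroup ℚ}
    (hτμ : τ ∈ rootsOfUnityFixer ℚ (3 ^ (k' + 1)))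
    (hτ : ∀ j, j ≤ k' → Nonempty (cokerSubOne (W.torsionGaloisModule (((3 : ℕ) : ℤ) ^ j * ((3 : ℕ) : ℤ))) τ ≃+
      ZMod (3 ^ (j + 1))))
    (D : KolyvaginDatum (W.torsionGaloisModule (((3 : ℕ) : ℤ) ^ k * ((3 : ℕ) : ℤ))))
    (η : (q : HeightOneSpectrum (𝓞 ℚ)) → (ZMod (Ideal.absNorm q.asIdeal))ˣ)
    (hη : ∀ q, Subgroup.zpowers (η q) = ⊤)
    (hP : D.primes = frobeniusClassPrimes (W.torsionGaloisModule (((3 : ℕ) : ℤ) ^ k' * ((3 : ℕ) : ℤ)))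
      S τ (3 ^ (k' + 1)))
    (hT : D.transverse = cyclotomicTransverse _) (hD : D.HasCanonicalComparison (3 ^ (k + 1)) η) :
    ∃ Dt : (j : ℕ) → KolyvaginDatum (W.torsionGaloisModule (((3 : ℕ) : ℤ) ^ j * ((3 : ℕ) : ℤ))),
      Dt k = D ∧ ∀ j, j ≤ k' →
        (Dt j).primes = frobeniusClassPrimes (W.torsionGaloisModule (((3 : ℕ) : ℤ) ^ k' * ((3 : ℕ) : ℤ)))
            S τ (3 ^ (k' + 1)) ∧
          (Dt j).transverse = cyclotomicTransverse _ ∧ (Dt j).HasCanonicalComparison (3 ^ (j + 1)) η := by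
  haveI : Fact (Nat.Prime 3) := ⟨Nat.prime_three⟩
  haveI : ∀ j, Finite (geomTorsion W (((3 : ℕ) : ℤ) ^ j * ((3 : ℕ) : ℤ))) := fun j =>
    finite_geomTorsion_pow_mul W 3 j
  -- at every `j ≤ k′`, a deep datum exists (n1011's constructor)
  have hex : ∀ j, j ≤ k' → ∃ Dj : KolyvaginDatum (W.torsionGaloisModule (((3 : ℕ) : ℤ) ^ j * ((3 : ℕ) : ℤ))),
      Dj.primes = frobeniusClassPrimes (W.torsionGaloisModule (((3 : ℕ) : ℤ) ^ k' * ((3 : ℕ) : ℤ)))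
          S τ (3 ^ (k' + 1)) ∧
        Dj.transverse = cyclotomicTransverse _ ∧ Dj.HasCanonicalComparison (3 ^ (j + 1)) η := by
    intro j hj
    haveI : NeZero (3 ^ (j + 1)) := ⟨pow_ne_zero _ three_ne_zero⟩
    exact S24Deep.exists_kolyvaginDatum_hasCanonicalComparison_frobeniusClassPrimes_deep _ _ _ _
      (fun u hu => S24Deep.torsionGaloisModule_pow_mul_eq_one_of_le W ((3 : ℕ) : ℤ) hj u hu)
      (pow_dvd_pow 3 (Nat.succ_le_succ hj)) S hτμ (hτ j hj) _ η (fun q _ => hη q)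
  -- the tower: `D` at `k`, a chosen deep datum at `j ≤ k′`, `j ≠ k`, anything elsewhere
  let Dt : (j : ℕ) → KolyvaginDatum (W.torsionGaloisModule (((3 : ℕ) : ℤ) ^ j * ((3 : ℕ) : ℤ))) := fun j =>
    if hjk : j = k then
      cast (congrArg (fun i => KolyvaginDatum (W.torsionGaloisModule (((3 : ℕ) : ℤ) ^ i * ((3 : ℕ) : ℤ))))
        hjk.symm) D
    else if hj : j ≤ k' then Classical.choose (hex j hj)
    else ⟨∅, cyclotomicTransverse _, fun _ => 0⟩
  have hDk : Dt k = D := by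
    change (if hjk : k = k then cast _ D else _) = D
    rw [dif_pos rfl]
    rfl
  refine ⟨Dt, hDk, fun j hj => ?_⟩
  by_cases hjk : j = k
  · subst hjk
    rw [hDk]
    exact ⟨hP, hT, hD⟩
  · have hDj : Dt j = Classical.choose (hex j hj) := by
      change (if hjk : j = k then cast _ D else if hj : j ≤ k' then Classical.choose (hex j hj) else _) = _
      rw [dif_neg hjk, dif_pos hj]
    rw [hDj]
    exact Classical.choose_spec (hex j hj)

omit [W.IsElliptic] in
/-- **The `E[3]`-datum on the deep class** `𝒫′ = frobeniusClassPrimes (E[3^{k′}·3]) S τ 3^{k′+1}` with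
cyclotomic transverse conditions and canonical comparison at `3` for a given `η` generating everywhere
(n1011's deep constructor; `E[3]/(τ−1) ≃ ℤ/3`, `τ ∈ Γ_{ℚ(μ_{3^{k′+1}})}`).
[cite: Rubin2011, Def. 1.9.6 and Def. 2.1.3] [cite: MazurRubin2004, §3.5 (H.5) (p. 27)] -/
theorem exists_deepDatum_torsion_three [Finite (geomTorsion W ((3 : ℕ) : ℤ))] (k' : ℕ)
    (S : Set (HeightOneSpectrum (𝓞 ℚ))) {τ : absoluteGaloisGroup ℚ}
    (hτμ : τ ∈ rootsOfUnityFixer ℚ (3 ^ (k' + 1)))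
    (hτq : Nonempty (cokerSubOne (W.torsionGaloisModule ((3 : ℕ) : ℤ)) τ ≃+ ZMod 3))
    (η : (q : HeightOneSpectrum (𝓞 ℚ)) → (ZMod (Ideal.absNorm q.asIdeal))ˣ)
    (hη : ∀ q, Subgroup.zpowers (η q) = ⊤) :
    ∃ D₁ : KolyvaginDatum (W.torsionGaloisModule ((3 : ℕ) : ℤ)),
      D₁.primes = frobeniusClassPrimes (W.torsionGaloisModule (((3 : ℕ) : ℤ) ^ k' * ((3 : ℕ) : ℤ)))
          S τ (3 ^ (k' + 1)) ∧
        D₁.transverse = cyclotomicTransverse _ ∧ D₁.HasCanonicalComparison 3 η := by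
  haveI : Fact (Nat.Prime 3) := ⟨Nat.prime_three⟩
  have hker : ∀ u : absoluteGaloisGroup ℚ,
      W.torsionGaloisModule (((3 : ℕ) : ℤ) ^ k' * ((3 : ℕ) : ℤ)) u = 1 →
        W.torsionGaloisModule ((3 : ℕ) : ℤ) u = 1 :=
    fun u hu => S24Deep.torsionGaloisModule_eq_one_of_dvd W (Dvd.intro_left _ rfl) u hu
  exact S24Deep.exists_kolyvaginDatum_hasCanonicalComparison_frobeniusClassPrimes_deep _ _ 3 _ hker
    (dvd_pow_self 3 (Nat.succ_ne_zero k')) S hτμ hτq _ η (fun q _ => hη q)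

end Torsion

end Summit.BirchSwinnertonDyer.BirchSwinnertonDyer.Theorems.KimAtThreeDeepLowerS24DeepTower

end
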